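import Summits.QuantumFields.YangMills.Theorems.BalabanUVNodesN15KingModelFullPropagatorGrad
import Summits.QuantumFields.YangMills.Theorems.BalabanUVNodesN15KingModelFullPropagatorProfileDecay

/-!
# BalabanUVNodes ∕ N15 — THE KING-MODEL RUNG, CURVED EDITION (PART V-a): THE MIXED SECOND DIFFERENCE `∂^η_{x,μ}∂^η_{y,ν}G^η_K(x, y)` OF THE FULL
# `A = 0` FLUCTUATION PROPAGATOR — the UV profile `|N²δ^{(1)}_μδ^{(2)}_νG^η_K(x, y)| ≤ C·Σ_{i<K}(L^{d+1})^i·e^{−δ·r·L^i∕L^K}` for ALL pairs, the level-by-level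
# form of King's Prop. 3.7 (3.63) with `|a| = |b| = 1`, «`(L^jη)^{2−d−|a|−|b|}`» SUMMED over (2.17) — UNIFORMLY in `K`, the volume and the mass
# (Track A, DAG node N15 = NE2; FAN-OUT v1.1 §N15 s3 «KING-MODEL RUNG … + the one-line statement of what the curved case adds»)

HONEST FRAMING.  Count-neutral kernel bookkeeping (cell `pub-ymgap`, seat `pub-ymgap-dag-n15-e` g9; `--supports stmt-QuantumFields-20544
--as helper` = K3⁷ `SpineGivenEndpointR13SepCoPH`, WORDS-143).  TEMPLATE LITERATURE, `A = 0`: C. King's scalar U(1)-Higgs MODEL on finite tori ([King1986]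
§2.2 p. 653 (2.13)–(2.17), p. 654 (2.20), Theorem 3.3 pp. 655–656, Prop. 3.7 (3.63) p. 663 «`|D^a_xD^b_yG^η_{(j)}(x, y)| ≤ C(L^jη)^{2−d−|a|−|b|}exp[−δ₀(L^jη)^{−1}|x
− y|]`»; King's `d` = this file's `d + 1`), NOT Bałaban's covariant objects; the profile below is the (2.17)-SUMMED SHAPE of the `|a| = |b| = 1` clause of
(3.63) for King's (2.13) at `A = 0`, NOT a printed proposition; NE2⁺ is NOT PRINTED and not proved here; NOT a node discharge; nothing continuum ∕ ℝ⁴ ∕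
OS ∕ mass-gap ∕ Clay.  0 `sorry`, 0 `def`, standard axioms.

THE POINT.  Parts R-a∕R-c proved the all-pairs level profiles of `G^η_K` and of its gradient in ONE variable (`fullPropD_*`: `∂` on `x`; `fullPropD2_*`: `∂` on
`y`, by symmetry).  THIS FILE differentiates BOTH legs: the mixed second difference
`DD_{μν}G(x, y) := N·(N·[G(x + e_μ, y + e_ν) − G(x, y + e_ν)] − N·[G(x + e_μ, y) − G(x, y)])` (`N = L^K`, `G = constrainedProp (L^K) M (aK a L K) ((L^K)²) m²`,
level-`K` lattice units) — the kernel of [B9]'s (3.44) object `∇_UG∇*_Uλ` at `U ≡ 1` (the sequel `…FullPropagatorMixedOperator`).  Unlike `∂_x∂_xG` (the averaging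
term `a_KP_K` of [Ba 4] (1.6) jumps across block faces: `G ∉ C²` in `x`), the MIXED difference IS of the printed size, by the peel: per level the two
η-differences cost `L·L`, so the factor is `ΛL² = (L^{d+1}∕L²)·L·L = L^{d+1}`, and the slice term has BOTH legs differentiated,
`N²δ₁δ₂ ksSlice = Σ_w(Σ_z ∂ℋ(x, z)C(z, w))∂ℋ(y, w)` (§1 `ksDDSlice_eq`), decaying by part M′ `ksDH_decay_unif` on both legs (§1 `ksDDSlice_decay_unif`).
* §1 `triple_sub_right`, `triple_smul_right`, `ksDDSlice_eq`, `ksDDSlice_decay_unif`, `fullPropDD_peel`;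
* §2 ★★ **`fullPropDD_profile_unif`** — `∃ C, δ > 0 ∀ K ≥ 1 ∀ N = L^K ∀ cube 2L^e ∀ 0 < m² ≤ m₀² ∀ μ ν x y,
  |DD_{μν}G(x, y)| ≤ C·Σ_{i<K} (ΛL²)^i·exp(−δ·r(x, y)·L^i∕N)` — ALL pairs (base = [Ba 4] (1.10) clause 2 at the two source points `y, y + e_ν`
  (`constrainedProp_deriv_decay_blocks_unif`, `tdistT_add_unitVec_le`), step = §1's peel + §1's slice decay + IH, all read in fine distance);
* the sequel `…FullPropagatorMixedPowerLaw` sums the levels: `|DD_{μν}G(x, y)| ≤ C·((L^K)∕r)^{d+1}` (`x ≠ y`; King's (3.63) with `|a| = |b| = 1`), the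
  diagonal order `(L^K)^{d+1}`, and the profile × the block decay `e^{−δ|B(x) − B(y)|}`.
WHAT THE CURVED CASE ADDS (one line): the same mixed-derivative profile for `∇_UG_k(U)∇*_U` uniformly over the live window `Reg335`.
HONEST SCOPE.  (i) `A = 0`, periodic b.c., odd `L ≥ 3`, `0 < m² ≤ m₀²`, cubes `2L^e`; (ii) lattice units of level `K` (each forward η-difference carries a
factor `N = L^K`); sup torus distance; (iii) `K ≥ 1`; every `d ≥ 0`; (iv) one difference in EACH variable only (no `∂_x∂_x`, honest: unbounded in `K`);
(v) not Bałaban's `G_k(U)`; not a discharge.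
Locators: [King1986] C. King, CMP **102** (1986) 649–677: (2.13)–(2.17) p. 653, (2.20) p. 654, Theorem 3.3 p. 655, (3.7) p. 656, Prop. 3.7 (3.63) p. 663,
(4.42)–(4.44) p. 675; [Ba 4] = [Balaban1983RegularityDecay] Theorem (1.10) p. 573 (clause 2), (1.6) p. 572.
-/

noncomputable section

namespace Summit.QuantumFields.YangMills.BalabanUVNodes.N15KingModelRung.Curved

open Real Finset Matrix
open Literature.MathematicalPhysics.QuantumFieldTheory.Balaban1983to89 (Params)
open Literature.MathematicalPhysics.QuantumFieldTheory.Balaban1983to89.B4Sect5Proof (latticeConst)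
open Literature.MathematicalPhysics.QuantumFieldTheory.Balaban1983to89.B5Prop11Plancherel (Tor fine unitVec)
open Literature.MathematicalPhysics.QuantumFieldTheory.King1986 (aK aK_pos aK_le)
open Literature.MathematicalPhysics.QuantumFieldTheory.King1986.Torus (constrainedProp flatten blockOf tdistT flatten_add flatten_unitVec
  tdistT_nonneg tdistT_symm tdistT_triangle tdistT_sumBound tdistT_add_unitVec_le gam0L kapCT kapCT_pos_le
  constrainedProp_deriv_decay_blocks_unif)
open Summit.QuantumFields.YangMills.BalabanUVNodes.N15.KingModel (kingRho kingRhoB)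

variable {d : ℕ} (L : ℕ) [NeZero L]

/-! ## §1 The doubly differentiated slice and the doubly differentiated peel -/

omit [NeZero L] in
/-- Additivity of the triple contraction in its last leg. [folklore] -/
theorem triple_sub_right {U : Type*} [Fintype U] (f : U → ℝ) (C : Matrix U U ℝ) (g g' : U → ℝ) :
    triple f C (fun w => g w - g' w) = triple f C g - triple f C g' := by
  simp only [triple, mul_sub, Finset.sum_sub_distrib]

omit [NeZero L] in
/-- Linearity of the triple contraction in its last leg (scalars). [folklore] -/
theorem triple_smul_right {U : Type*} [Fintype U] (s : ℝ) (f : U → ℝ) (C : Matrix U U ℝ) (g : U → ℝ) :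
    triple f C (fun w => s * g w) = s * triple f C g := by
  rw [triple, triple, Finset.mul_sum]
  refine Finset.sum_congr rfl fun w _ => ?_
  ring

/-- **THE DOUBLY DIFFERENTIATED SLICE**: `L^j·[ksDSlice_μ(x, y + e_ν) − ksDSlice_μ(x, y)] = Σ_w(Σ_z ∂^η_μℋ_j(x, z)·C^{(j)}(z, w))·∂^η_νℋ_j(y, w)` —
(4.42) with BOTH outer legs differentiated (the `y`-leg through `triple_sub_right`∕`triple_smul_right`; part 3's `dkingH` by `rfl`).
[cite: King1986, (4.42) p.675, Prop. 3.7 (3.63) p.663 (object `D^a_xD^b_yG_{(j)}`)] -/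
theorem ksDDSlice_eq (a m2 : ℝ) (i : KSliceIdx d) (μ ν : Fin (d + 1)) (x y : Tor (fine (L ^ i.j) (ksU L i))) :
    ((L ^ i.j : ℕ) : ℝ) * (ksDSlice L a m2 i μ x (y + unitVec (fine (L ^ i.j) (ksU L i)) ν) - ksDSlice L a m2 i μ x y)
      = triple (ksDH L a m2 i μ x) (ksC L a m2 i) (ksDH L a m2 i ν y) := by
  rw [ksDSlice, ksDSlice, ← triple_sub_right, ← triple_smul_right]
  rfl

/-- **DECAY OF THE DOUBLY DIFFERENTIATED SLICE, ONE `(C, δ)` FOR ALL MASSES `0 < m² ≤ m₀²`**: for every index, directions and points,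
`|Σ_w(Σ_z ∂ℋ(x, z)C(z, w))∂ℋ(y, w)| ≤ C·e^{−δ|B(x) − B(y)|_U}` — King's (3.63)-type decay of `∂^η_x∂^η_yG_{(j)} = (∂ℋ)C(∂ℋ)ᵀ` from the decay of its three
factors (part M′ `ksDH_decay_unif` on both legs, n15-d's `kingCov_abs_le`; part M v1.1 `triple_decay` at the common rate).
[cite: King1986, Prop. 3.7 (3.63) p.663, (4.34) p.674, (4.41)–(4.42) p.675] -/
theorem ksDDSlice_decay_unif (hLodd : Odd L) (hL : 2 ≤ L) {a : ℝ} (ha : 0 < a) {m0sq : ℝ} (hm0 : 0 ≤ m0sq) :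
    ∃ C δ : ℝ, 0 < C ∧ 0 < δ ∧ ∀ (m2 : ℝ), 0 < m2 → m2 ≤ m0sq → ∀ (i : KSliceIdx d) (μ ν : Fin (d + 1))
      (x y : Tor (fine (L ^ i.j) (ksU L i))),
      |triple (ksDH L a m2 i μ x) (ksC L a m2 i) (ksDH L a m2 i ν y)|
        ≤ C * Real.exp (-(δ * tdistT (ksU L i) (blockOf (L ^ i.j) (ksU L i) x) (blockOf (L ^ i.j) (ksU L i) y))) := by
  obtain ⟨δ₂, cD, hδ₂, hcD, Ddec⟩ := ksDH_decay_unif (d := d) L hLodd hL ha hm0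
  have hcC := ksC_const_pos (d := d) L hL ha
  obtain ⟨hκ', _⟩ := kapCT_pos_le (d := d + 1) ha hL
  obtain ⟨κ, hκ, hκ₂, hκC⟩ : ∃ κ : ℝ, 0 < κ ∧ κ ≤ δ₂ ∧ κ ≤ kapCT (d + 1) a L :=
    ⟨min δ₂ (kapCT (d + 1) a L), lt_min hδ₂ hκ', min_le_left _ _, min_le_right _ _⟩
  set cC : ℝ := (gam0L (d + 1) a L - (kingRho (d + 1) a L + kingRhoB (d + 1) a L))⁻¹ with hcC_def
  refine ⟨cD * cC * cD * latticeConst (d + 1) (κ / 2) ^ 2 + 1, κ / 2, by positivity, half_pos hκ, fun m2 hm hcap i μ ν x y => ?_⟩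
  have ht0 := tdistT_nonneg (ksU L i)
  have exp_rate_mono : ∀ {κ' r t : ℝ}, κ' ≤ r → 0 ≤ t → Real.exp (-(r * t)) ≤ Real.exp (-(κ' * t)) :=
    fun hκr ht => Real.exp_le_exp.mpr (neg_le_neg (mul_le_mul_of_nonneg_right hκr ht))
  have hVs : ∀ u : Tor (ksU L i), ∑ z, Real.exp (-(κ / 2 * tdistT (ksU L i) u z)) ≤ latticeConst (d + 1) (κ / 2) := fun u =>
    tdistT_sumBound (ksU L i) (κ / 2) (half_pos hκ) u
  have hV2 : cD * cC * cD * latticeConst (d + 1) (κ / 2) ^ 2 ≤ cD * cC * cD * latticeConst (d + 1) (κ / 2) ^ 2 + 1 := by linarith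
  have hA : ∀ z, |ksDH L a m2 i μ x z| ≤ cD * Real.exp (-(κ * tdistT (ksU L i) (blockOf (L ^ i.j) (ksU L i) x) z)) := fun z =>
    ((Ddec m2 hm.le hcap i μ).1 x z).trans (mul_le_mul_of_nonneg_left (exp_rate_mono hκ₂ (ht0 _ _)) hcD.le)
  have hB : ∀ w, |ksDH L a m2 i ν y w| ≤ cD * Real.exp (-(κ * tdistT (ksU L i) w (blockOf (L ^ i.j) (ksU L i) y))) := fun w => by
    rw [tdistT_symm]
    exact ((Ddec m2 hm.le hcap i ν).1 y w).trans (mul_le_mul_of_nonneg_left (exp_rate_mono hκ₂ (ht0 _ _)) hcD.le)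
  have hCm : ∀ z w, |ksC L a m2 i z w| ≤ cC * Real.exp (-(κ * tdistT (ksU L i) z w)) := fun z w =>
    ((ksC_decay L hL ha hm i z w).1).trans (mul_le_mul_of_nonneg_left (exp_rate_mono hκC (ht0 _ _)) hcC.le)
  have key := triple_decay (tdistT (ksU L i)) ht0 (tdistT_triangle (ksU L i)) hκ.le hcD.le hcC.le hcD.le hA hCm hB hVs
  exact key.trans (mul_le_mul_of_nonneg_right hV2 (Real.exp_pos _).le)

/-- **THE DOUBLY DIFFERENTIATED PEEL**: for every slice index `i = (e, K = i.j, …)`, `a > 0`, `m² > 0`, `L ≥ 2`, directions `μ, ν` and nested points `x, y`,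
`DD_{μν}G(K+1, M_e, m²)(flatten x, flatten y) = (L^{d+1}∕L²)·L·L·[DD_{μν}G(K, fine L M_e, m²∕L²)(x, y) + Σ_w(Σ_z ∂ℋ(x, z)C(z, w))∂ℋ(y, w)]` — part O-a′'s
differentiated peel at the two source points `y + e_ν`, `y` (the flattened lattice step is the nested lattice step, `flatten_unitVec`) and `ksDDSlice_eq`.
[cite: King1986, (2.17) p.653, (2.20) p.654, (4.42) p.675] -/
theorem fullPropDD_peel (hL : 2 ≤ L) {a msq : ℝ} (ha : 0 < a) (hm : 0 < msq) (i : KSliceIdx d) (μ ν : Fin (d + 1))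
    (x y : Tor (fine (L ^ i.j) (ksU L i))) :
    ((L ^ i.j * L : ℕ) : ℝ) * (((L ^ i.j * L : ℕ) : ℝ) *
        (constrainedProp (L ^ i.j * L) (ksM L i) (aK a L (i.j + 1)) (((L ^ i.j * L : ℕ) : ℝ) ^ 2) msq
            (flatten (L ^ i.j) L (ksM L i) x + unitVec (fine (L ^ i.j * L) (ksM L i)) μ)
            (flatten (L ^ i.j) L (ksM L i) y + unitVec (fine (L ^ i.j * L) (ksM L i)) ν)
          - constrainedProp (L ^ i.j * L) (ksM L i) (aK a L (i.j + 1)) (((L ^ i.j * L : ℕ) : ℝ) ^ 2) msq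
            (flatten (L ^ i.j) L (ksM L i) x) (flatten (L ^ i.j) L (ksM L i) y + unitVec (fine (L ^ i.j * L) (ksM L i)) ν))
      - ((L ^ i.j * L : ℕ) : ℝ) *
        (constrainedProp (L ^ i.j * L) (ksM L i) (aK a L (i.j + 1)) (((L ^ i.j * L : ℕ) : ℝ) ^ 2) msq
            (flatten (L ^ i.j) L (ksM L i) x + unitVec (fine (L ^ i.j * L) (ksM L i)) μ) (flatten (L ^ i.j) L (ksM L i) y)
          - constrainedProp (L ^ i.j * L) (ksM L i) (aK a L (i.j + 1)) (((L ^ i.j * L : ℕ) : ℝ) ^ 2) msq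
            (flatten (L ^ i.j) L (ksM L i) x) (flatten (L ^ i.j) L (ksM L i) y)))
      = (L : ℝ) ^ (d + 1) / (L : ℝ) ^ 2 * L * L *
          (((L ^ i.j : ℕ) : ℝ) * (((L ^ i.j : ℕ) : ℝ) *
              (constrainedProp (L ^ i.j) (ksU L i) (aK a L i.j) (((L ^ i.j : ℕ) : ℝ) ^ 2) (msq / (L : ℝ) ^ 2)
                  (x + unitVec (fine (L ^ i.j) (ksU L i)) μ) (y + unitVec (fine (L ^ i.j) (ksU L i)) ν)
                - constrainedProp (L ^ i.j) (ksU L i) (aK a L i.j) (((L ^ i.j : ℕ) : ℝ) ^ 2) (msq / (L : ℝ) ^ 2)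
                  x (y + unitVec (fine (L ^ i.j) (ksU L i)) ν))
            - ((L ^ i.j : ℕ) : ℝ) *
              (constrainedProp (L ^ i.j) (ksU L i) (aK a L i.j) (((L ^ i.j : ℕ) : ℝ) ^ 2) (msq / (L : ℝ) ^ 2)
                  (x + unitVec (fine (L ^ i.j) (ksU L i)) μ) y
                - constrainedProp (L ^ i.j) (ksU L i) (aK a L i.j) (((L ^ i.j : ℕ) : ℝ) ^ 2) (msq / (L : ℝ) ^ 2) x y))
            + triple (ksDH L a (msq / (L : ℝ) ^ 2) i μ x) (ksC L a (msq / (L : ℝ) ^ 2) i)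
                (ksDH L a (msq / (L : ℝ) ^ 2) i ν y)) := by
  rw [← flatten_unitVec (L ^ i.j) L (ksM L i) ν, ← flatten_add, fullPropD_peel L hL ha hm i μ x (y + _),
    fullPropD_peel L hL ha hm i μ x y, ← ksDDSlice_eq]
  push_cast
  ring

/-! ## §2 The profile of the mixed second difference: `|DD_{μν}G^η_K(x, y)| ≤ C·Σ_{i<K} (ΛL²)^i·e^{−δ·r·L^i∕L^K}`, all pairs -/

/-- **THE UV PROFILE OF THE MIXED SECOND DIFFERENCE OF KING'S FULL `A = 0` FLUCTUATION PROPAGATOR**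
(`DD_{μν}G(x, y) = L^K·(L^K·[G(x + e_μ, y + e_ν) − G(x, y + e_ν)] − L^K·[G(x + e_μ, y) − G(x, y)])`, `G = constrainedProp (L^K) M (aK a L K) ((L^K)²) m²`, level-`K`
lattice units): for odd `L ≥ 3`, `a > 0` and a mass cap `m₀² ≥ 0` there are `C, δ > 0` (functions of `d, L, a, m₀²`) such that for EVERY `K ≥ 1` (spelling
`N = L^K`), cube `M_μ = 2L^e`, mass `0 < m² ≤ m₀²`, directions `μ, ν` and ALL fine points `x, y` at fine torus distance `r`:
`|DD_{μν}G(x, y)| ≤ C·Σ_{i<K} (ΛL²)^i·exp(−δ·r·L^i∕N)`, `ΛL² = (L^{d+1}∕L²)·L·L` — the `|a| = |b| = 1` clause of Prop. 3.7 (3.63)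
«`C(L^jη)^{−d}exp[−δ₀(L^jη)^{−1}|x − y|]`» summed over (2.17), for the FULL propagator, uniformly in `K`.  Induction on `K` (§1's peel + §1's slice
decay + [Ba 4] (1.10) clause 2 at the two source points at the bottom, read in fine distance through part R-a §1).
[cite: King1986, (2.13)–(2.17) p.653, (2.20) p.654, Theorem 3.3 p.655, (3.7) p.656, Prop. 3.7 (3.63) p.663, (4.42)–(4.44) p.675; Balaban1983RegularityDecay, Theorem (1.10) p.573] -/
theorem fullPropDD_profile_unif (hLodd : Odd L) (hL : 2 ≤ L) {a : ℝ} (ha : 0 < a) {m0sq : ℝ} (hm0 : 0 ≤ m0sq) :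
    ∃ C δ : ℝ, 0 < C ∧ 0 < δ ∧ ∀ (K : ℕ), 1 ≤ K → ∀ (N : ℕ) [NeZero N], N = L ^ K →
      ∀ (e : ℕ) (M : Fin (d + 1) → ℕ) [∀ μ, NeZero (M μ)], (∀ μ, M μ = 2 * L ^ e) →
      ∀ (msq : ℝ), 0 < msq → msq ≤ m0sq → ∀ (μ ν : Fin (d + 1)) (x y : Tor (fine N M)),
        |(N : ℝ) * ((N : ℝ) * (constrainedProp N M (aK a L K) (((N : ℕ) : ℝ) ^ 2) msq (x + unitVec (fine N M) μ) (y + unitVec (fine N M) ν)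
              - constrainedProp N M (aK a L K) (((N : ℕ) : ℝ) ^ 2) msq x (y + unitVec (fine N M) ν))
            - (N : ℝ) * (constrainedProp N M (aK a L K) (((N : ℕ) : ℝ) ^ 2) msq (x + unitVec (fine N M) μ) y
              - constrainedProp N M (aK a L K) (((N : ℕ) : ℝ) ^ 2) msq x y))|
          ≤ C * ∑ i ∈ Finset.range K, ((L : ℝ) ^ (d + 1) / (L : ℝ) ^ 2 * L * L) ^ i
              * Real.exp (-(δ * (tdistT (fine N M) x y * (L : ℝ) ^ i / (N : ℝ)))) := by
  have hL1 : 1 < L := by omega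
  have hLr : (1 : ℝ) ≤ L := by exact_mod_cast hL1.le
  have hL0 : (0 : ℝ) < L := by positivity
  -- the base constants ([Ba 4] (1.10) clause 2, point source) and the doubly differentiated slice constants (§1)
  obtain ⟨δb, cb, hδb, hcb, Hb⟩ := constrainedProp_deriv_decay_blocks_unif (d + 1) L (by omega) ⟨hLodd, hL1⟩ ha hm0
  obtain ⟨Cs, κ, hCs, hκ, Hs⟩ := ksDDSlice_decay_unif (d := d) L hLodd hL ha hm0
  -- the constants of the theorem
  set Λ : ℝ := (L : ℝ) ^ (d + 1) / (L : ℝ) ^ 2 * L * L with hΛdef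
  have hΛ : 0 < Λ := by positivity
  set δ : ℝ := min δb κ with hδdef
  have hδ : 0 < δ := lt_min hδb hκ
  have hδb' : δ ≤ δb := min_le_left _ _
  have hδκ : δ ≤ κ := min_le_right _ _
  set C : ℝ := max (2 * ((L : ℝ) * ((L : ℝ) ^ (d + 1) * cb)) * Real.exp δb * Real.exp δ) (Λ * Cs * Real.exp κ) with hCdef
  have hC : 0 < C := lt_max_of_lt_right (by positivity)
  have hCb : 2 * ((L : ℝ) * ((L : ℝ) ^ (d + 1) * cb)) * Real.exp δb * Real.exp δ ≤ C := le_max_left _ _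
  have hCsC : Λ * Cs * Real.exp κ ≤ C := le_max_right _ _
  refine ⟨C, δ, hC, hδ, ?_⟩
  intro K hK
  induction K, hK using Nat.le_induction with
  | base =>
    -- `K = 1`: (1.10) clause 2 with a point source at `y + e_ν` and at `y`, block currency, read in fine distance
    intro N _ hN e M _ hM msq hmsq hcap μ ν x y
    subst hN
    set P : Params := ⟨d + 1, L, e, 1, by omega, ⟨hLodd, hL1⟩⟩ with hPdef
    have hMK : ∀ μ, M μ = P.sitesPerDir P.K := fun μ => by
      rw [hM μ]
      simp [hPdef, Params.sitesPerDir]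
    set y' := y + unitVec (fine (L ^ 1) M) ν with hy'def
    have h1 := Hb P rfl rfl le_rfl msq hmsq.le hcap M hMK (L ^ 1) rfl x y' μ
    have h0 := Hb P rfl rfl le_rfl msq hmsq.le hcap M hMK (L ^ 1) rfl x y μ
    have hcast : (((L ^ 1 : ℕ) : ℝ)) ^ P.d * cb = (L : ℝ) ^ (d + 1) * cb := by
      simp [hPdef]
    rw [hcast] at h1 h0
    set D : ℝ := tdistT M (blockOf (L ^ 1) M x) (blockOf (L ^ 1) M y) with hDdef
    set D' : ℝ := tdistT M (blockOf (L ^ 1) M x) (blockOf (L ^ 1) M y') with hD'def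
    set r : ℝ := tdistT (fine (L ^ 1) M) x y with hrdef
    set r' : ℝ := tdistT (fine (L ^ 1) M) x y' with hr'def
    have hN1 : ((L ^ 1 : ℕ) : ℝ) = L := by push_cast; ring
    have hfine : r ≤ (L : ℝ) * D + ((L : ℝ) - 1) := by
      have h' := tdistT_fine_le_blocks (L ^ 1) M x y
      rwa [hN1] at h'
    have hfine' : r' ≤ (L : ℝ) * D' + ((L : ℝ) - 1) := by
      have h' := tdistT_fine_le_blocks (L ^ 1) M x y'
      rwa [hN1] at h'
    -- the shifted source is within fine distance `1`: `r ≤ r′ + 1`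
    have hrr' : r ≤ r' + 1 := by
      have ht := tdistT_triangle (fine (L ^ 1) M) x y' y
      have hs : tdistT (fine (L ^ 1) M) y' y ≤ 1 := by
        rw [tdistT_symm]; exact tdistT_add_unitVec_le (fine (L ^ 1) M) y ν
      linarith
    have hexp0 : Real.exp (-(δb * D)) ≤ Real.exp δb * Real.exp (-(δ * (r / L))) :=
      exp_block_decay_le hLr le_rfl (tdistT_nonneg _ x y) hδ.le hδb' hfine
    have hexp1 : Real.exp (-(δb * D')) ≤ Real.exp δb * Real.exp δ * Real.exp (-(δ * (r / L))) := by
      have h1' : Real.exp (-(δb * D')) ≤ Real.exp δb * Real.exp (-(δ * (r' / L))) :=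
        exp_block_decay_le hLr le_rfl (tdistT_nonneg _ x y') hδ.le hδb' hfine'
      have h2 : Real.exp (-(δ * (r' / L))) ≤ Real.exp δ * Real.exp (-(δ * (r / L))) := by
        rw [← Real.exp_add]
        apply Real.exp_le_exp.mpr
        have h3 : δ * (r / L) ≤ δ * (r' / L) + δ := by
          have h4 : r / L ≤ r' / L + 1 / L := by
            rw [← add_div]; exact div_le_div_of_nonneg_right hrr' hL0.le
          have h5 : 1 / (L : ℝ) ≤ 1 := by rw [div_le_one hL0]; exact hLr
          nlinarith [mul_le_mul_of_nonneg_left h4 hδ.le]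
        linarith
      calc Real.exp (-(δb * D')) ≤ Real.exp δb * Real.exp (-(δ * (r' / L))) := h1'
        _ ≤ Real.exp δb * (Real.exp δ * Real.exp (-(δ * (r / L)))) := mul_le_mul_of_nonneg_left h2 (Real.exp_pos _).le
        _ = Real.exp δb * Real.exp δ * Real.exp (-(δ * (r / L))) := by ring
    have hE1 : (1 : ℝ) ≤ Real.exp δ := Real.one_le_exp hδ.le
    rw [Finset.sum_range_one, pow_zero, pow_zero, one_mul, mul_one]
    conv_rhs => rw [hN1]
    -- `|N·(A(y′) − A(y))| ≤ N·(|A(y′)| + |A(y)|)`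
    set A1 : ℝ := (((L ^ 1 : ℕ) : ℝ)) * (constrainedProp (L ^ 1) M (aK a L 1) (((L ^ 1 : ℕ) : ℝ) ^ 2) msq
        (x + unitVec (fine (L ^ 1) M) μ) y' - constrainedProp (L ^ 1) M (aK a L 1) (((L ^ 1 : ℕ) : ℝ) ^ 2) msq x y') with hA1
    set A0 : ℝ := (((L ^ 1 : ℕ) : ℝ)) * (constrainedProp (L ^ 1) M (aK a L 1) (((L ^ 1 : ℕ) : ℝ) ^ 2) msq
        (x + unitVec (fine (L ^ 1) M) μ) y - constrainedProp (L ^ 1) M (aK a L 1) (((L ^ 1 : ℕ) : ℝ) ^ 2) msq x y) with hA0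
    rw [hN1]
    calc |(L : ℝ) * (A1 - A0)| = (L : ℝ) * |A1 - A0| := by rw [abs_mul, abs_of_pos hL0]
      _ ≤ (L : ℝ) * (|A1| + |A0|) := mul_le_mul_of_nonneg_left (abs_sub _ _) hL0.le
      _ ≤ (L : ℝ) * ((L : ℝ) ^ (d + 1) * cb * Real.exp (-(δb * D')) + (L : ℝ) ^ (d + 1) * cb * Real.exp (-(δb * D))) :=
          mul_le_mul_of_nonneg_left (add_le_add h1 h0) hL0.le
      _ ≤ (L : ℝ) * ((L : ℝ) ^ (d + 1) * cb * (Real.exp δb * Real.exp δ * Real.exp (-(δ * (r / L))))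
            + (L : ℝ) ^ (d + 1) * cb * (Real.exp δb * Real.exp δ * Real.exp (-(δ * (r / L))))) := by
          refine mul_le_mul_of_nonneg_left (add_le_add (mul_le_mul_of_nonneg_left hexp1 (by positivity))
            (mul_le_mul_of_nonneg_left (hexp0.trans ?_) (by positivity))) hL0.le
          have := mul_le_mul_of_nonneg_right hE1 (mul_nonneg (Real.exp_pos δb).le (Real.exp_pos (-(δ * (r / L)))).le)
          linarith
      _ = 2 * ((L : ℝ) * ((L : ℝ) ^ (d + 1) * cb)) * Real.exp δb * Real.exp δ * Real.exp (-(δ * (r / L))) := by ring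
      _ ≤ C * Real.exp (-(δ * (r / L))) := mul_le_mul_of_nonneg_right hCb (Real.exp_pos _).le
  | succ K hK IH =>
    intro N _ hN e M _ hM msq hmsq hcap μ ν xf yf
    subst hN
    obtain rfl : M = fun _ => 2 * L ^ e := funext hM
    set i : KSliceIdx d := ⟨e, K, hK, 1, le_rfl, 0, Nat.zero_le e, 1, le_rfl⟩ with hidef
    obtain ⟨x, rfl⟩ := (flatten (L ^ K) L (ksM L i)).surjective xf
    obtain ⟨y, rfl⟩ := (flatten (L ^ K) L (ksM L i)).surjective yf
    -- the fine distance (preserved by the peel) and the block distance one level down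
    set r : ℝ := tdistT (fine (L ^ K) (ksU L i)) x y with hrdef
    set Dsub : ℝ := tdistT (ksU L i) (blockOf (L ^ K) (ksU L i) x) (blockOf (L ^ K) (ksU L i) y) with hDsubdef
    set NK : ℝ := ((L ^ K : ℕ) : ℝ) with hNKdef
    have hNK1 : 1 ≤ NK := by
      rw [hNKdef]
      exact_mod_cast Nat.one_le_pow K L (by omega)
    have hNK0 : 0 < NK := by linarith
    have hNKL : NK ≤ NK * L := le_mul_of_one_le_right hNK0.le hLr
    have hcastN : ((L ^ K * L : ℕ) : ℝ) = NK * L := by rw [hNKdef]; push_cast; ring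
    have hr0 : 0 ≤ r := tdistT_nonneg _ x y
    have hfine : r ≤ NK * Dsub + (NK - 1) := tdistT_fine_le_blocks (L ^ K) (ksU L i) x y
    -- the mass one level down
    have hL2 : (0 : ℝ) < (L : ℝ) ^ 2 := by positivity
    have hm2 : 0 < msq / (L : ℝ) ^ 2 := div_pos hmsq hL2
    have hm2cap : msq / (L : ℝ) ^ 2 ≤ m0sq := by
      have h1 : (1 : ℝ) ≤ (L : ℝ) ^ 2 := one_le_pow₀ hLr
      exact (div_le_self hmsq.le h1).trans hcap
    -- the mixed difference one level down and the slice term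
    set A : ℝ := ((L ^ K : ℕ) : ℝ) * (((L ^ K : ℕ) : ℝ) *
              (constrainedProp (L ^ K) (ksU L i) (aK a L K) (((L ^ K : ℕ) : ℝ) ^ 2) (msq / (L : ℝ) ^ 2)
                  (x + unitVec (fine (L ^ K) (ksU L i)) μ) (y + unitVec (fine (L ^ K) (ksU L i)) ν)
                - constrainedProp (L ^ K) (ksU L i) (aK a L K) (((L ^ K : ℕ) : ℝ) ^ 2) (msq / (L : ℝ) ^ 2)
                  x (y + unitVec (fine (L ^ K) (ksU L i)) ν))
            - ((L ^ K : ℕ) : ℝ) *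
              (constrainedProp (L ^ K) (ksU L i) (aK a L K) (((L ^ K : ℕ) : ℝ) ^ 2) (msq / (L : ℝ) ^ 2)
                  (x + unitVec (fine (L ^ K) (ksU L i)) μ) y
                - constrainedProp (L ^ K) (ksU L i) (aK a L K) (((L ^ K : ℕ) : ℝ) ^ 2) (msq / (L : ℝ) ^ 2) x y)) with hAdef
    set S : ℝ := triple (ksDH L a (msq / (L : ℝ) ^ 2) i μ x) (ksC L a (msq / (L : ℝ) ^ 2) i)
        (ksDH L a (msq / (L : ℝ) ^ 2) i ν y) with hSdef
    -- the induction hypothesis on the finer cube, ALL pairs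
    have hM' : ∀ μ, ksU L i μ = 2 * L ^ (e + 1) := fun μ => by
      show L * (2 * L ^ e) = 2 * L ^ (e + 1)
      ring
    have hIH : |A| ≤ C * ∑ j ∈ Finset.range K, Λ ^ j * Real.exp (-(δ * (r * (L : ℝ) ^ j / NK))) :=
      IH (L ^ K) rfl (e + 1) (ksU L i) hM' (msq / (L : ℝ) ^ 2) hm2 hm2cap μ ν x y
    -- the slice term, read in fine distance at the NEW top scale `NK·L`
    have hS : |S| ≤ Cs * Real.exp (-(κ * Dsub)) := Hs (msq / (L : ℝ) ^ 2) hm2 hm2cap i μ ν x y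
    have hexpS : Real.exp (-(κ * Dsub)) ≤ Real.exp κ * Real.exp (-(δ * (r / (NK * L)))) :=
      exp_block_decay_le hNK1 hNKL hr0 hδ.le hδκ hfine
    have hS' : |S| ≤ Cs * Real.exp κ * Real.exp (-(δ * (r / (NK * L)))) := by
      calc |S| ≤ Cs * Real.exp (-(κ * Dsub)) := hS
        _ ≤ Cs * (Real.exp κ * Real.exp (-(δ * (r / (NK * L))))) := mul_le_mul_of_nonneg_left hexpS hCs.le
        _ = Cs * Real.exp κ * Real.exp (-(δ * (r / (NK * L)))) := by ring
    -- the peel (§1, by name; the type restated in the goal's spelling)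
    have hpeel : ((L ^ K * L : ℕ) : ℝ) * (((L ^ K * L : ℕ) : ℝ) *
            (constrainedProp (L ^ K * L) (ksM L i) (aK a L (K + 1)) (((L ^ K * L : ℕ) : ℝ) ^ 2) msq
                (flatten (L ^ K) L (ksM L i) x + unitVec (fine (L ^ K * L) (ksM L i)) μ)
                (flatten (L ^ K) L (ksM L i) y + unitVec (fine (L ^ K * L) (ksM L i)) ν)
              - constrainedProp (L ^ K * L) (ksM L i) (aK a L (K + 1)) (((L ^ K * L : ℕ) : ℝ) ^ 2) msq
                (flatten (L ^ K) L (ksM L i) x) (flatten (L ^ K) L (ksM L i) y + unitVec (fine (L ^ K * L) (ksM L i)) ν))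
          - ((L ^ K * L : ℕ) : ℝ) *
            (constrainedProp (L ^ K * L) (ksM L i) (aK a L (K + 1)) (((L ^ K * L : ℕ) : ℝ) ^ 2) msq
                (flatten (L ^ K) L (ksM L i) x + unitVec (fine (L ^ K * L) (ksM L i)) μ) (flatten (L ^ K) L (ksM L i) y)
              - constrainedProp (L ^ K * L) (ksM L i) (aK a L (K + 1)) (((L ^ K * L : ℕ) : ℝ) ^ 2) msq
                (flatten (L ^ K) L (ksM L i) x) (flatten (L ^ K) L (ksM L i) y)))
        = Λ * (A + S) :=
      fullPropDD_peel L hL ha hmsq i μ ν x y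
    -- the level sums
    have hshift : ∀ j : ℕ, Λ ^ (j + 1) * Real.exp (-(δ * (r * (L : ℝ) ^ (j + 1) / (NK * L))))
        = Λ * (Λ ^ j * Real.exp (-(δ * (r * (L : ℝ) ^ j / NK)))) := fun j => by
      have he : r * (L : ℝ) ^ (j + 1) / (NK * L) = r * (L : ℝ) ^ j / NK := by
        rw [pow_succ, ← mul_assoc, mul_div_mul_right _ _ hL0.ne']
      rw [he, pow_succ]
      ring
    have hsum : ∑ j ∈ Finset.range (K + 1), Λ ^ j * Real.exp (-(δ * (r * (L : ℝ) ^ j / (NK * L))))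
        = Real.exp (-(δ * (r / (NK * L))))
          + Λ * ∑ j ∈ Finset.range K, Λ ^ j * Real.exp (-(δ * (r * (L : ℝ) ^ j / NK))) := by
      rw [Finset.sum_range_succ', pow_zero, pow_zero, one_mul, mul_one, Finset.mul_sum, add_comm]
      congr 1
      exact Finset.sum_congr rfl fun j _ => hshift j
    -- the goal in the peel's spelling, fine distance through `tdistT_flatten`
    show |((L ^ K * L : ℕ) : ℝ) * (((L ^ K * L : ℕ) : ℝ) *
            (constrainedProp (L ^ K * L) (ksM L i) (aK a L (K + 1)) (((L ^ K * L : ℕ) : ℝ) ^ 2) msq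
                (flatten (L ^ K) L (ksM L i) x + unitVec (fine (L ^ K * L) (ksM L i)) μ)
                (flatten (L ^ K) L (ksM L i) y + unitVec (fine (L ^ K * L) (ksM L i)) ν)
              - constrainedProp (L ^ K * L) (ksM L i) (aK a L (K + 1)) (((L ^ K * L : ℕ) : ℝ) ^ 2) msq
                (flatten (L ^ K) L (ksM L i) x) (flatten (L ^ K) L (ksM L i) y + unitVec (fine (L ^ K * L) (ksM L i)) ν))
          - ((L ^ K * L : ℕ) : ℝ) *
            (constrainedProp (L ^ K * L) (ksM L i) (aK a L (K + 1)) (((L ^ K * L : ℕ) : ℝ) ^ 2) msq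
                (flatten (L ^ K) L (ksM L i) x + unitVec (fine (L ^ K * L) (ksM L i)) μ) (flatten (L ^ K) L (ksM L i) y)
              - constrainedProp (L ^ K * L) (ksM L i) (aK a L (K + 1)) (((L ^ K * L : ℕ) : ℝ) ^ 2) msq
                (flatten (L ^ K) L (ksM L i) x) (flatten (L ^ K) L (ksM L i) y)))|
        ≤ C * ∑ j ∈ Finset.range (K + 1), Λ ^ j * Real.exp (-(δ *
            (tdistT (fine (L ^ K * L) (ksM L i)) (flatten (L ^ K) L (ksM L i) x) (flatten (L ^ K) L (ksM L i) y)
              * (L : ℝ) ^ j / ((L ^ K * L : ℕ) : ℝ))))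
    rw [hpeel, tdistT_flatten, hcastN, ← hrdef, hsum, abs_mul, abs_of_nonneg hΛ.le]
    set PS : ℝ := ∑ j ∈ Finset.range K, Λ ^ j * Real.exp (-(δ * (r * (L : ℝ) ^ j / NK))) with hPSdef
    set E : ℝ := Real.exp (-(δ * (r / (NK * L)))) with hEdef
    have hE0 : 0 < E := Real.exp_pos _
    calc Λ * |A + S| ≤ Λ * (|A| + |S|) := mul_le_mul_of_nonneg_left (abs_add_le _ _) hΛ.le
      _ ≤ Λ * (C * PS + Cs * Real.exp κ * E) := mul_le_mul_of_nonneg_left (add_le_add hIH hS') hΛ.le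
      _ = C * (Λ * PS) + Λ * Cs * Real.exp κ * E := by ring
      _ ≤ C * (Λ * PS) + C * E := by
          have := mul_le_mul_of_nonneg_right hCsC hE0.le
          linarith
      _ = C * (E + Λ * PS) := by ring

end Summit.QuantumFields.YangMills.BalabanUVNodes.N15KingModelRung.Curved
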